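import Mathlib
import Literature.Combinatorics.Additive.Kneser
import Summits.MatrixMultiplication.MatrixMultiplication.Theorems.SoloBlindSdppGadget

/-!
# Oriented SDPP gadgets: the Kneser cut inequality (solo-blind seat, Lemma K)

For an oriented SDPP gadget `(P s, Q s)_{s ∈ ι}` with difference set `D` in a finite abelian group `G`
(own differences `q - p ∈ D`, cross differences `q - p ∉ D` for `q ∈ Q s`, `p ∈ P s'`, `s < s'`),
and any cut `I < J` of the index order, the sets `U := ⋃_{s ∈ I} Q s` and `V := ⋃_{t ∈ J} (-P t)`
satisfy `U + V ⊆ G ∖ D`.  Kneser's addition theorem (tree: `Literature.Combinatorics.Additive`)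
then gives the counting condition used by the seat's search engine `exact6`:
there is `k = |Stab(U+V)|`, a divisor of `|G|` with `k ≤ |G| - |D|`, and multiples `u, v` of `k` with
`∑_{s∈I} |Q s| ≤ u`, `∑_{t∈J} |P t| ≤ v` and `u + v ≤ (|G| - |D|) + k`.
In a group of prime order this is the Cauchy–Davenport form `∑_I |Q s| + ∑_J |P t| ≤ |G| - |D| + 1`
whenever `U + V ≠ G`.
-/

namespace Summit.MatrixMultiplication.MatrixMultiplication.Theorems

open Finset
open scoped Pointwise

variable {G : Type*} [AddCommGroup G] [DecidableEq G]
variable {ι : Type*} [LinearOrder ι]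

omit [DecidableEq G] in
/-- In an oriented gadget the sets `Q s` are pairwise disjoint. -/
theorem soloSdpp_disjoint_Q (P Q : ι → Finset G) (D : Finset G)
    (hown : ∀ s, ∀ p ∈ P s, ∀ q ∈ Q s, q - p ∈ D)
    (hcross : ∀ s s', s < s' → ∀ p ∈ P s', ∀ q ∈ Q s, q - p ∉ D)
    (hne : ∀ s, (P s).Nonempty) :
    ∀ s s', s ≠ s' → Disjoint (Q s) (Q s') := by
  intro s s' hss'
  rw [Finset.disjoint_left]
  intro q hq hq'
  rcases lt_or_gt_of_ne hss' with h | h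
  · obtain ⟨p, hp⟩ := hne s'
    exact hcross s s' h p hp q hq (hown s' p hp q hq')
  · obtain ⟨p, hp⟩ := hne s
    exact hcross s' s h p hp q hq' (hown s p hp q hq)

/-- The cut sumset: for `I < J`, `(⋃_{s∈I} Q s) + (⋃_{t∈J} -P t)` avoids `D`. -/
theorem soloSdpp_cut_add_subset [Fintype G] (I J : Finset ι) (P Q : ι → Finset G) (D : Finset G)
    (hcross : ∀ s s', s < s' → ∀ p ∈ P s', ∀ q ∈ Q s, q - p ∉ D)
    (hIJ : ∀ s ∈ I, ∀ t ∈ J, s < t) :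
    I.biUnion Q + J.biUnion (fun t => (P t).image (fun p : G => -p)) ⊆ Finset.univ \ D := by
  intro x hx
  rw [Finset.mem_add] at hx
  obtain ⟨q, hq, y, hy, rfl⟩ := hx
  rw [Finset.mem_biUnion] at hq hy
  obtain ⟨s, hs, hqs⟩ := hq
  obtain ⟨t, ht, hyt⟩ := hy
  rw [Finset.mem_image] at hyt
  obtain ⟨p, hp, rfl⟩ := hyt
  rw [Finset.mem_sdiff]
  refine ⟨Finset.mem_univ _, ?_⟩
  have : q + -p = q - p := by abel
  rw [this]
  exact hcross s t (hIJ s hs t ht) p hp q hqs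

/-- Cardinality of the `Q`-side of a cut. -/
theorem soloSdpp_card_biUnion_Q (I : Finset ι) (P Q : ι → Finset G) (D : Finset G)
    (hown : ∀ s, ∀ p ∈ P s, ∀ q ∈ Q s, q - p ∈ D)
    (hcross : ∀ s s', s < s' → ∀ p ∈ P s', ∀ q ∈ Q s, q - p ∉ D)
    (hneP : ∀ s, (P s).Nonempty) :
    (I.biUnion Q).card = ∑ s ∈ I, (Q s).card := by
  refine Finset.card_biUnion ?_
  intro x _ y _ hxy
  exact soloSdpp_disjoint_Q P Q D hown hcross hneP x y hxy

/-- Cardinality of the `-P`-side of a cut. -/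
theorem soloSdpp_card_biUnion_negP (J : Finset ι) (P Q : ι → Finset G) (D : Finset G)
    (hown : ∀ s, ∀ p ∈ P s, ∀ q ∈ Q s, q - p ∈ D)
    (hcross : ∀ s s', s < s' → ∀ p ∈ P s', ∀ q ∈ Q s, q - p ∉ D)
    (hneQ : ∀ s, (Q s).Nonempty) :
    (J.biUnion (fun t => (P t).image (fun p : G => -p))).card = ∑ t ∈ J, (P t).card := by
  have hdisj := soloSdpp_disjoint_P P Q D hown hcross hneQ
  rw [Finset.card_biUnion]
  · refine Finset.sum_congr rfl ?_
    intro t _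
    exact Finset.card_image_of_injective _ neg_injective
  · intro x _ y _ hxy
    change Disjoint ((P x).image (fun p : G => -p)) ((P y).image (fun p : G => -p))
    rw [Finset.disjoint_left]
    intro a ha ha'
    rw [Finset.mem_image] at ha ha'
    obtain ⟨p, hp, rfl⟩ := ha
    obtain ⟨p', hp', hpp'⟩ := ha'
    have : p' = p := neg_injective hpp'
    subst this
    exact Finset.disjoint_left.mp (hdisj x y hxy) hp hp'

/-- **Lemma K (Kneser cut inequality).**  For any cut `I < J` (both nonempty) of an oriented SDPP
gadget in a finite abelian group there are `k ∣ |G|` (the order of the stabilizer of the cut sumset,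
`k ≤ |G| - |D|`) and multiples `u, v` of `k` with `∑_{s∈I} |Q s| ≤ u`, `∑_{t∈J} |P t| ≤ v`,
`u + v ≤ (|G| - |D|) + k`. -/
theorem soloSdpp_cut_kneser [Fintype G] (I J : Finset ι) (P Q : ι → Finset G) (D : Finset G)
    (hown : ∀ s, ∀ p ∈ P s, ∀ q ∈ Q s, q - p ∈ D)
    (hcross : ∀ s s', s < s' → ∀ p ∈ P s', ∀ q ∈ Q s, q - p ∉ D)
    (hneP : ∀ s, (P s).Nonempty) (hneQ : ∀ s, (Q s).Nonempty)
    (hIJ : ∀ s ∈ I, ∀ t ∈ J, s < t) (hI : I.Nonempty) (hJ : J.Nonempty) :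
    ∃ k u v : ℕ, k ∣ Fintype.card G ∧ 1 ≤ k ∧ k ≤ Fintype.card G - D.card ∧ k ∣ u ∧ k ∣ v ∧
      ∑ s ∈ I, (Q s).card ≤ u ∧ ∑ t ∈ J, (P t).card ≤ v ∧
      u + v ≤ (Fintype.card G - D.card) + k := by
  set U : Finset G := I.biUnion Q with hU
  set V : Finset G := J.biUnion (fun t => (P t).image (fun p : G => -p)) with hV
  have hUne : U.Nonempty := by
    obtain ⟨s, hs⟩ := hI
    obtain ⟨q, hq⟩ := hneQ s
    exact ⟨q, Finset.mem_biUnion.mpr ⟨s, hs, hq⟩⟩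
  have hVne : V.Nonempty := by
    obtain ⟨t, ht⟩ := hJ
    obtain ⟨p, hp⟩ := hneP t
    exact ⟨-p, Finset.mem_biUnion.mpr ⟨t, ht, Finset.mem_image.mpr ⟨p, hp, rfl⟩⟩⟩
  have hUVne : (U + V).Nonempty := hUne.add hVne
  set K : Finset G := (U + V).addStab with hK
  have hKne : K.Nonempty := hUVne.addStab
  have h0K : (0 : G) ∈ K := hUVne.zero_mem_addStab
  have hsub : U + V ⊆ Finset.univ \ D := soloSdpp_cut_add_subset I J P Q D hcross hIJ
  have hcardUV : (U + V).card ≤ Fintype.card G - D.card := by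
    have := Finset.card_le_card hsub
    rwa [Finset.card_univ_sdiff] at this
  have hkn := Literature.Combinatorics.Additive.add_kneser (s := U) (t := V)
  have hcardU : U.card = ∑ s ∈ I, (Q s).card := soloSdpp_card_biUnion_Q I P Q D hown hcross hneP
  have hcardV : V.card = ∑ t ∈ J, (P t).card := soloSdpp_card_biUnion_negP J P Q D hown hcross hneQ
  refine ⟨K.card, (U + K).card, (V + K).card, hUVne.card_addStab_dvd_card_univ, hKne.card_pos, ?_,
    Finset.card_addStab_dvd_card_add_addStab U (U + V),
    Finset.card_addStab_dvd_card_add_addStab V (U + V), ?_, ?_, ?_⟩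
  · exact (Finset.card_addStab_le_card).trans hcardUV
  · rw [← hcardU]; exact Finset.card_le_card (Finset.subset_add_left U h0K)
  · rw [← hcardV]; exact Finset.card_le_card (Finset.subset_add_left V h0K)
  · calc (U + K).card + (V + K).card ≤ (U + V).card + K.card := hkn
      _ ≤ (Fintype.card G - D.card) + K.card := by omega

/-- **Lemma K, prime order (Cauchy–Davenport form).**  In `ZMod p`, for any cut `I < J` of an
oriented SDPP gadget whose cut sumset is not the whole group (automatic when `D` is nonempty),
`∑_{s∈I} |Q s| + ∑_{t∈J} |P t| ≤ (p - |D|) + 1`. -/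
theorem soloSdpp_cut_prime {p : ℕ} [Fact p.Prime] (I J : Finset ι)
    (P Q : ι → Finset (ZMod p)) (D : Finset (ZMod p))
    (hown : ∀ s, ∀ p ∈ P s, ∀ q ∈ Q s, q - p ∈ D)
    (hcross : ∀ s s', s < s' → ∀ p ∈ P s', ∀ q ∈ Q s, q - p ∉ D)
    (hneP : ∀ s, (P s).Nonempty) (hneQ : ∀ s, (Q s).Nonempty)
    (hIJ : ∀ s ∈ I, ∀ t ∈ J, s < t) (hI : I.Nonempty) (hJ : J.Nonempty) (hD : D.Nonempty) :
    ∑ s ∈ I, (Q s).card + ∑ t ∈ J, (P t).card ≤ (p - D.card) + 1 := by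
  set U : Finset (ZMod p) := I.biUnion Q with hU
  set V : Finset (ZMod p) := J.biUnion (fun t => (P t).image (fun p : ZMod p => -p)) with hV
  have hUne : U.Nonempty := by
    obtain ⟨s, hs⟩ := hI
    obtain ⟨q, hq⟩ := hneQ s
    exact ⟨q, Finset.mem_biUnion.mpr ⟨s, hs, hq⟩⟩
  have hVne : V.Nonempty := by
    obtain ⟨t, ht⟩ := hJ
    obtain ⟨p, hp⟩ := hneP t
    exact ⟨-p, Finset.mem_biUnion.mpr ⟨t, ht, Finset.mem_image.mpr ⟨p, hp, rfl⟩⟩⟩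
  have hsub : U + V ⊆ Finset.univ \ D := soloSdpp_cut_add_subset I J P Q D hcross hIJ
  have hcardUV : (U + V).card ≤ p - D.card := by
    have := Finset.card_le_card hsub
    rwa [Finset.card_univ_sdiff, ZMod.card] at this
  have hcd := ZMod.cauchy_davenport (Fact.out : p.Prime) hUne hVne
  have hcardU : U.card = ∑ s ∈ I, (Q s).card := soloSdpp_card_biUnion_Q I P Q D hown hcross hneP
  have hcardV : V.card = ∑ t ∈ J, (P t).card := soloSdpp_card_biUnion_negP J P Q D hown hcross hneQ
  have hDle : D.card ≤ p := by
    have := Finset.card_le_univ D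
    rwa [ZMod.card] at this
  have hDpos : 0 < D.card := hD.card_pos
  rw [← hcardU, ← hcardV]
  rcases Nat.lt_or_ge (U.card + V.card - 1) p with h | h
  · rw [min_eq_right (le_of_lt h)] at hcd
    omega
  · rw [min_eq_left h] at hcd
    omega

end Summit.MatrixMultiplication.MatrixMultiplication.Theorems
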